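import Summits.AtomisticToContinuum.HydrodynamicLimit.Theorems.JParityClosureParityRigidityIdentify
import HarnessLib

/-!
# Diagonal parity rigidity (stub S3c-b `stub_diagonalParityRigidity`, line `preshock-kinetic-slaving`,
# crux `JParityClosure.EvenStressEnskog`, stmt-AtomisticToContinuum-13079) — the Gaussian energy and
# invariance from Gaussian-averaged detailed balance

The exact-case mechanism behind the missing estimate of the diagonal rigidity (the diagonal collision
invariance of the limit pair law, antecedent of the landed reduction
`stub_diagonalParityRigidity_of_ae_map_collide_eq`).  For finite measures on a Euclidean space `F` and the
Gaussian kernel `K_τ(z) = e^{-(τ/2)‖z‖²}`: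

* `integral_integral_exp_neg_mul_norm_sq_sub` (Bochner representation): `∫∫ K_τ(x - y) dν(y) dμ(x) =
  ∫ Re(μ̂ \bar ν̂) dγ_τ`, `γ_τ` the centred Maxwellian law of temperature `τ` (whose characteristic function IS
  `K_τ`, tree `charFun_withDensity_localMaxwellian`) — Fubini only, no Plancherel;
* `integral_norm_charFun_sub_sq_eq` (the GAUSSIAN ENERGY of a difference):
  `∫ ‖μ̂ - ν̂‖² dγ_τ = I(μ,μ) - 2 I(μ,ν) + I(ν,ν)`, `I(μ,ν) = ∫∫ K_τ(x - y) dν dμ` — positivity of the kernel;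
* `map_eq_self_of_ae_integral_gaussian_comp_eq` (INVARIANCE FROM AVERAGED DETAILED BALANCE; its instance on the
  pair space `WithLp 2 (V3 × V3)` is the registered sub-goal `stub_diagonalParityRigidity_energyInvariance`): if `T` is a measurable isometry of `F` and the `K_τ`-average of `T_# ν` equals that of `ν` at
  `ν`-almost every point, `∫ K_τ(x - T y) dν(y) = ∫ K_τ(x - y) dν(y)` for `ν`-a.e. `x`, then `T_# ν = ν`:
  integrating the hypothesis gives `I(ν, T_#ν) = I(ν,ν)`, the isometry gives `I(T_#ν, T_#ν) = I(ν,ν)`, so the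
  energy of `ν - T_# ν` vanishes, the characteristic functions agree `γ_τ`-a.e., hence everywhere
  (continuity, `γ_τ ∼ Lebesgue`), hence `T_# ν = ν` (`Measure.ext_of_charFun`).

For the pair law `ν = m ⊗ m` and `T = collide ω` the hypothesis of the last theorem is `e^{-F_ϑ} = 1` `ν`-a.e.
at ONE width `ϑ = τ^{-1/2}` (`surprisal_eq`), so this is a fixed-width form of `ParityRigidity`; its STABILITY
along `ν_n → ν`, `τ_n → ∞` with `∫ B |1 - e^{-F_n}| dν_n → 0` (landed `stub_diagonalParityRigidity_defect`) is
exactly the missing diagonal estimate: `I_n(ν_n - T_#ν_n) = 2 ∫ a_n (1 - e^{-F_n}) dν_n` with the UNBOUNDED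
weight `a_n = ν_n ∗ G_n` (bounded iff the mollified window laws have bounded densities).

References: S. Bochner, *Vorlesungen über Fouriersche Integrale* (1932) §20 (positive-definite kernels);
C. Villani, *A review of mathematical topics in collisional kinetic theory* (2002) Ch. 2 §4.
-/

noncomputable section

open scoped InnerProductSpace Topology ENNReal NNReal ComplexConjugate
open MeasureTheory Filter Set Metric Real Complex
open Literature.Analysis.FluidPDE
open Summit.AtomisticToContinuum.HydrodynamicLimit.Theorems.ParityRigidity

namespace Summit.AtomisticToContinuum.HydrodynamicLimit.Theorems.EvenStressEnskog

section Energy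

variable {F : Type*} [NormedAddCommGroup F] [InnerProductSpace ℝ F] [FiniteDimensional ℝ F]
  [MeasurableSpace F] [BorelSpace F]

/-- The Gaussian kernel `e^{-(τ/2)‖z‖²}` is the characteristic function of the centred Maxwellian law of
temperature `τ`. [folklore] -/
theorem ofReal_exp_neg_mul_norm_sq_eq_charFun {τ : ℝ} (hτ : 0 < τ) (z : F) :
    ((Real.exp (-(τ / 2) * ‖z‖ ^ 2) : ℝ) : ℂ) =
      charFun ((volume : Measure F).withDensity fun w => ENNReal.ofReal (localMaxwellian 1 τ 0 w)) z := by
  rw [charFun_withDensity_localMaxwellian hτ 0 z, inner_zero_left, Complex.ofReal_zero, zero_mul,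
    Complex.exp_zero, one_mul]

omit [InnerProductSpace ℝ F] [FiniteDimensional ℝ F] [MeasurableSpace F] [BorelSpace F] in
/-- The Gaussian kernel is bounded by `1`. [folklore] -/
theorem abs_exp_neg_mul_norm_sq_le {τ : ℝ} (hτ : 0 < τ) (z : F) :
    |Real.exp (-(τ / 2) * ‖z‖ ^ 2)| ≤ 1 := by
  rw [abs_of_pos (Real.exp_pos _)]
  exact Real.exp_le_one_iff.2 (by nlinarith [sq_nonneg ‖z‖])

/-- A bounded continuous real function of two variables is integrable in the second variable against a finite
measure, as a function on the product with any finite measure: the Gaussian kernel `K_τ(x - y)` is integrable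
for `μ ⊗ ν`. [folklore] -/
theorem integrable_exp_neg_mul_norm_sq_sub (μ ν : Measure F) [IsFiniteMeasure μ] [IsFiniteMeasure ν]
    {τ : ℝ} (hτ : 0 < τ) :
    Integrable (fun p : F × F => Real.exp (-(τ / 2) * ‖p.1 - p.2‖ ^ 2)) (μ.prod ν) := by
  refine (integrable_const (1 : ℝ)).mono' (Continuous.aestronglyMeasurable (by fun_prop))
    (Eventually.of_forall fun p => ?_)
  rw [Real.norm_eq_abs]
  exact abs_exp_neg_mul_norm_sq_le hτ _

/-- **Bochner representation of the Gaussian energy.**  For finite measures `μ, ν`,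
`∫∫ e^{-(τ/2)‖x-y‖²} dν(y) dμ(x) = ∫ Re(μ̂(w) \overline{ν̂(w)}) dγ_τ(w)` with `γ_τ` the centred Maxwellian law of
temperature `τ`. [folklore] -/
theorem integral_integral_exp_neg_mul_norm_sq_sub (μ ν : Measure F) [IsFiniteMeasure μ]
    [IsFiniteMeasure ν] {τ : ℝ} (hτ : 0 < τ) :
    ∫ x, ∫ y, Real.exp (-(τ / 2) * ‖x - y‖ ^ 2) ∂ν ∂μ =
      ∫ w, (charFun μ w * conj (charFun ν w)).re
        ∂((volume : Measure F).withDensity fun w => ENNReal.ofReal (localMaxwellian 1 τ 0 w)) := by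
  set γ : Measure F := (volume : Measure F).withDensity fun w => ENNReal.ofReal (localMaxwellian 1 τ 0 w)
    with hγ
  haveI : IsFiniteMeasure γ := isFiniteMeasure_withDensity_localMaxwellian hτ 0
  -- the product formula for `μ̂ \bar ν̂`
  have hprod : ∀ w, charFun μ w * conj (charFun ν w) =
      ∫ p : F × F, cexp ((⟪p.1 - p.2, w⟫_ℝ : ℂ) * I) ∂(μ.prod ν) := by
    intro w
    rw [← charFun_neg, charFun_apply, charFun_apply, ← integral_prod_mul]
    refine integral_congr_ae (Eventually.of_forall fun p => ?_)
    show cexp ((⟪p.1, w⟫_ℝ : ℂ) * I) * cexp ((⟪p.2, -w⟫_ℝ : ℂ) * I) = cexp ((⟪p.1 - p.2, w⟫_ℝ : ℂ) * I)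
    rw [← Complex.exp_add, inner_sub_left, inner_neg_right]
    push_cast
    ring_nf
  -- the character as a function of `(w, p)` is bounded and continuous
  set Φ : F → F × F → ℂ := fun w p => cexp ((⟪p.1 - p.2, w⟫_ℝ : ℂ) * I) with hΦ
  have hΦn : ∀ w p, ‖Φ w p‖ ≤ 1 := fun w p => by
    rw [hΦ, Complex.norm_exp_ofReal_mul_I]
  have hint : Integrable (Function.uncurry Φ) (γ.prod (μ.prod ν)) := by
    refine (integrable_const (1 : ℝ)).mono' (Continuous.aestronglyMeasurable ?_)
      (Eventually.of_forall fun q => hΦn q.1 q.2)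
    show Continuous fun q : F × (F × F) => cexp ((⟪q.2.1 - q.2.2, q.1⟫_ℝ : ℂ) * I)
    fun_prop
  -- the inner `w`-integral is the Gaussian kernel
  have hinner : ∀ p : F × F, ∫ w, Φ w p ∂γ = ((Real.exp (-(τ / 2) * ‖p.1 - p.2‖ ^ 2) : ℝ) : ℂ) := by
    intro p
    rw [ofReal_exp_neg_mul_norm_sq_eq_charFun hτ, charFun_apply]
    refine integral_congr_ae (Eventually.of_forall fun w => ?_)
    simp only [hΦ, real_inner_comm w]
  calc ∫ x, ∫ y, Real.exp (-(τ / 2) * ‖x - y‖ ^ 2) ∂ν ∂μ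
      = ∫ p, Real.exp (-(τ / 2) * ‖p.1 - p.2‖ ^ 2) ∂(μ.prod ν) :=
        (integral_prod _ (integrable_exp_neg_mul_norm_sq_sub μ ν hτ)).symm
    _ = (∫ p, ((Real.exp (-(τ / 2) * ‖p.1 - p.2‖ ^ 2) : ℝ) : ℂ) ∂(μ.prod ν)).re := by
        rw [integral_complex_ofReal, Complex.ofReal_re]
    _ = (∫ p, ∫ w, Φ w p ∂γ ∂(μ.prod ν)).re := by simp_rw [hinner]
    _ = (∫ w, ∫ p, Φ w p ∂(μ.prod ν) ∂γ).re := by rw [integral_integral_swap hint]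
    _ = ∫ w, (∫ p, Φ w p ∂(μ.prod ν)).re ∂γ := (integral_re hint.integral_prod_left).symm
    _ = ∫ w, (charFun μ w * conj (charFun ν w)).re ∂γ := by simp_rw [hprod, hΦ]

/-- **The Gaussian energy of a difference of finite measures.**
`∫ ‖μ̂ - ν̂‖² dγ_τ = I(μ,μ) - 2 I(μ,ν) + I(ν,ν)` with `I(μ,ν) = ∫∫ e^{-(τ/2)‖x-y‖²} dν(y) dμ(x)`: the
Gaussian kernel is positive definite in the sense of Bochner. [folklore] -/
theorem integral_norm_charFun_sub_sq_eq (μ ν : Measure F) [IsFiniteMeasure μ] [IsFiniteMeasure ν]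
    {τ : ℝ} (hτ : 0 < τ) :
    ∫ w, ‖charFun μ w - charFun ν w‖ ^ 2
        ∂((volume : Measure F).withDensity fun w => ENNReal.ofReal (localMaxwellian 1 τ 0 w)) =
      (∫ x, ∫ y, Real.exp (-(τ / 2) * ‖x - y‖ ^ 2) ∂μ ∂μ) -
        2 * (∫ x, ∫ y, Real.exp (-(τ / 2) * ‖x - y‖ ^ 2) ∂ν ∂μ) +
        ∫ x, ∫ y, Real.exp (-(τ / 2) * ‖x - y‖ ^ 2) ∂ν ∂ν := by
  set γ : Measure F := (volume : Measure F).withDensity fun w => ENNReal.ofReal (localMaxwellian 1 τ 0 w)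
    with hγ
  haveI : IsFiniteMeasure γ := isFiniteMeasure_withDensity_localMaxwellian hτ 0
  -- bounded measurable functions of `w` are `γ`-integrable
  have hbdd : ∀ (ρ₁ ρ₂ : Measure F) [IsFiniteMeasure ρ₁] [IsFiniteMeasure ρ₂],
      Integrable (fun w => (charFun ρ₁ w * conj (charFun ρ₂ w)).re) γ := by
    intro ρ₁ ρ₂ _ _
    refine (integrable_const (ρ₁.real Set.univ * ρ₂.real Set.univ)).mono' ?_
      (Eventually.of_forall fun w => ?_)
    · exact (Complex.continuous_re.comp ((continuous_charFun).mul
        (Complex.continuous_conj.comp continuous_charFun))).aestronglyMeasurable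
    · rw [Real.norm_eq_abs]
      calc |(charFun ρ₁ w * conj (charFun ρ₂ w)).re| ≤ ‖charFun ρ₁ w * conj (charFun ρ₂ w)‖ :=
            Complex.abs_re_le_norm _
        _ = ‖charFun ρ₁ w‖ * ‖charFun ρ₂ w‖ := by rw [norm_mul, Complex.norm_conj]
        _ ≤ ρ₁.real Set.univ * ρ₂.real Set.univ := by
            gcongr
            · exact norm_charFun_le w
            · exact norm_charFun_le w
  have hpt : ∀ w, ‖charFun μ w - charFun ν w‖ ^ 2 =
      (charFun μ w * conj (charFun μ w)).re - 2 * (charFun μ w * conj (charFun ν w)).re +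
        (charFun ν w * conj (charFun ν w)).re := by
    intro w
    rw [← Complex.normSq_eq_norm_sq, Complex.normSq_sub, Complex.mul_conj, Complex.mul_conj,
      Complex.ofReal_re, Complex.ofReal_re]
    ring
  simp_rw [hpt]
  have i2 : Integrable (fun w => 2 * (charFun μ w * conj (charFun ν w)).re) γ := (hbdd μ ν).const_mul 2
  have i1 : Integrable (fun w => (charFun μ w * conj (charFun μ w)).re -
      2 * (charFun μ w * conj (charFun ν w)).re) γ := (hbdd μ μ).sub i2
  rw [integral_add i1 (hbdd ν ν), integral_sub (hbdd μ μ) i2, integral_const_mul,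
    ← integral_integral_exp_neg_mul_norm_sq_sub μ μ hτ, ← integral_integral_exp_neg_mul_norm_sq_sub μ ν hτ,
    ← integral_integral_exp_neg_mul_norm_sq_sub ν ν hτ]

/-- **Invariance from Gaussian-averaged detailed balance (registered sub-goal).**  Let `T` be a measurable
isometry of a Euclidean space `F`, `ν` a finite measure and `τ > 0`.  If the Gaussian average of `T_# ν` equals
that of `ν` at `ν`-almost every point, `∫ e^{-(τ/2)‖x - T y‖²} dν(y) = ∫ e^{-(τ/2)‖x - y‖²} dν(y)` for `ν`-a.e.
`x`, then `T_# ν = ν`.  (For `ν = (m ⊗ m)`, `T = collide ω` the hypothesis is `e^{-F_ϑ} = 1` `ν`-a.e. at the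
single width `ϑ = τ^{-1/2}`.) [folklore] -/
theorem map_eq_self_of_ae_integral_gaussian_comp_eq (ν : Measure F) [IsFiniteMeasure ν] {T : F → F}
    (hT : Measurable T) (hiso : ∀ x y, ‖T x - T y‖ = ‖x - y‖) {τ : ℝ} (hτ : 0 < τ)
    (hDB : ∀ᵐ x ∂ν, ∫ y, Real.exp (-(τ / 2) * ‖x - T y‖ ^ 2) ∂ν =
      ∫ y, Real.exp (-(τ / 2) * ‖x - y‖ ^ 2) ∂ν) :
    ν.map T = ν := by
  set γ : Measure F := (volume : Measure F).withDensity fun w => ENNReal.ofReal (localMaxwellian 1 τ 0 w)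
    with hγ
  haveI : IsFiniteMeasure γ := isFiniteMeasure_withDensity_localMaxwellian hτ 0
  haveI : IsFiniteMeasure (ν.map T) := Measure.isFiniteMeasure_map ν T
  have hKc : Continuous fun p : F × F => Real.exp (-(τ / 2) * ‖p.1 - p.2‖ ^ 2) := by fun_prop
  -- `I(ν, T_# ν) = I(ν, ν)`
  have h1 : ∫ x, ∫ y, Real.exp (-(τ / 2) * ‖x - y‖ ^ 2) ∂(ν.map T) ∂ν =
      ∫ x, ∫ y, Real.exp (-(τ / 2) * ‖x - y‖ ^ 2) ∂ν ∂ν := by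
    have hx : ∀ x, ∫ y, Real.exp (-(τ / 2) * ‖x - y‖ ^ 2) ∂(ν.map T) =
        ∫ y, Real.exp (-(τ / 2) * ‖x - T y‖ ^ 2) ∂ν := fun x =>
      integral_map hT.aemeasurable (Continuous.aestronglyMeasurable (by fun_prop))
    simp_rw [hx]
    exact integral_congr_ae hDB
  -- `I(T_# ν, T_# ν) = I(ν, ν)`
  have h2 : ∫ x, ∫ y, Real.exp (-(τ / 2) * ‖x - y‖ ^ 2) ∂(ν.map T) ∂(ν.map T) =
      ∫ x, ∫ y, Real.exp (-(τ / 2) * ‖x - y‖ ^ 2) ∂ν ∂ν := by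
    have hsm : StronglyMeasurable fun x => ∫ y, Real.exp (-(τ / 2) * ‖x - y‖ ^ 2) ∂(ν.map T) :=
      StronglyMeasurable.integral_prod_right'
        (hKc.stronglyMeasurable : StronglyMeasurable
          (Function.uncurry fun x y : F => Real.exp (-(τ / 2) * ‖x - y‖ ^ 2)))
    rw [integral_map hT.aemeasurable hsm.aestronglyMeasurable]
    refine integral_congr_ae (Eventually.of_forall fun x => ?_)
    show ∫ y, Real.exp (-(τ / 2) * ‖T x - y‖ ^ 2) ∂(ν.map T) = ∫ y, Real.exp (-(τ / 2) * ‖x - y‖ ^ 2) ∂ν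
    rw [integral_map hT.aemeasurable (Continuous.aestronglyMeasurable (by fun_prop))]
    simp only [hiso]
  -- the energy of `ν - T_# ν` vanishes
  have h3 : ∫ w, ‖charFun ν w - charFun (ν.map T) w‖ ^ 2 ∂γ = 0 := by
    rw [hγ, integral_norm_charFun_sub_sq_eq ν (ν.map T) hτ, h1, h2]
    ring
  -- hence the characteristic functions agree `γ`-a.e., `volume`-a.e., everywhere
  have hcont : Continuous fun w => ‖charFun ν w - charFun (ν.map T) w‖ ^ 2 :=
    (continuous_charFun.sub continuous_charFun).norm.pow 2
  have hint : Integrable (fun w => ‖charFun ν w - charFun (ν.map T) w‖ ^ 2) γ := by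
    refine (integrable_const ((ν.real Set.univ + (ν.map T).real Set.univ) ^ 2)).mono'
      hcont.aestronglyMeasurable (Eventually.of_forall fun w => ?_)
    rw [Real.norm_eq_abs, abs_of_nonneg (sq_nonneg _)]
    gcongr
    exact (norm_sub_le _ _).trans (add_le_add (norm_charFun_le w) (norm_charFun_le w))
  have h4 : (fun w => ‖charFun ν w - charFun (ν.map T) w‖ ^ 2) =ᵐ[γ] 0 :=
    (integral_eq_zero_iff_of_nonneg (fun w => sq_nonneg _) hint).1 h3
  have h5 : (fun w => ‖charFun ν w - charFun (ν.map T) w‖ ^ 2) =ᵐ[(volume : Measure F)] fun _ => 0 := by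
    rw [hγ, Filter.EventuallyEq, ae_withDensity_iff
      (continuous_localMaxwellian τ 0).measurable.ennreal_ofReal] at h4
    filter_upwards [h4] with w hw
    exact hw (ENNReal.ofReal_pos.2 (localMaxwellian_pos hτ 0 w)).ne'
  have h6 : (fun w => ‖charFun ν w - charFun (ν.map T) w‖ ^ 2) = fun _ => 0 :=
    Measure.eq_of_ae_eq h5 hcont continuous_const
  refine Measure.ext_of_charFun (funext fun w => ?_)
  have hw := congrFun h6 w
  simp only [pow_eq_zero_iff, ne_eq, OfNat.ofNat_ne_zero, not_false_eq_true, norm_eq_zero,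
    sub_eq_zero] at hw
  exact hw.symm

end Energy

/-- **Registered sub-goal (pair space of the stub).**  On the Euclidean pair space `WithLp 2 (V3 × V3)`, `V3 = ℝ³`, of
`stub_diagonalParityRigidity` (where the tree transports `m ⊗ m` and the collision map `collide ω` is a linear
isometric involution, `norm_collideLp_sub`): a finite measure whose Gaussian average at width `τ^{-1/2}` is
unchanged, at almost every point of its support, by a measurable isometry `T`, is `T`-invariant.  With
`T = toLp ∘ collide ω ∘ ofLp` and `ν = (m ⊗ m) ∘ toLp⁻¹` the hypothesis reads `e^{-F_ϑ(ω,·)} = 1` `ν`-a.e.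
(`surprisal_eq`), i.e. exact detailed balance of the mollified pair law ON THE SUPPORT of the un-mollified one
at ONE width forces collision invariance. [folklore] -/
theorem stub_diagonalParityRigidity_energyInvariance :
  ∀ (ν : Measure (WithLp 2 (EuclideanSpace ℝ (Fin 3) × EuclideanSpace ℝ (Fin 3))))
    (T : WithLp 2 (EuclideanSpace ℝ (Fin 3) × EuclideanSpace ℝ (Fin 3)) →
      WithLp 2 (EuclideanSpace ℝ (Fin 3) × EuclideanSpace ℝ (Fin 3))) (τ : ℝ),
    IsFiniteMeasure ν → Measurable T → (∀ x y, ‖T x - T y‖ = ‖x - y‖) → 0 < τ →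
    (∀ᵐ x ∂ν, ∫ y, Real.exp (-(τ / 2) * ‖x - T y‖ ^ 2) ∂ν =
      ∫ y, Real.exp (-(τ / 2) * ‖x - y‖ ^ 2) ∂ν) →
    ν.map T = ν :=
  fun ν _ _ hν hT hiso hτ hDB => by
    haveI := hν
    exact map_eq_self_of_ae_integral_gaussian_comp_eq ν hT hiso hτ hDB

end Summit.AtomisticToContinuum.HydrodynamicLimit.Theorems.EvenStressEnskog

end
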